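import Literature.NumberTheory.LFunctions.ThetaChainCheck
import HarnessLib

/-!
# RH-FREE kernel certificate — «nothing here bears on the truth of RH»
# The error term of Mertens' second theorem is positive below `358 811`: the checker

Topic: `Literature/NumberTheory/LFunctions`. Rosser–Schoenfeld (Illinois J. Math. 6 (1962), Thms 20–21 and
p. 87) record that `E₂(x) = Σ_{p ≤ x} 1/p − log log x − B > 0` for `2 ≤ x ≤ 10⁸` (`B = 0.26149 72128…` the
Meissel–Mertens constant); T. Zhao (Res. Number Theory 11 (2025) 62, §1.1 and §2, first sentence) quotes it as
«`E_i(x) > 0` for `2 ≤ x ≤ 10⁸`» and uses it as the numerical input of his Theorem 1. This file is the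
*computable core* of a kernel certificate of that inequality on the initial range `3 ≤ x < 358 811` (the range
needed by the explicit form of Zhao's Theorem 1, clause `i = 2`, `MertensErrorTermsMeanValueRHThm1Clause2*.lean`),
walking the tree's complete prime table `ChainTable.table` (`ChainTableFacts.tableOK`) exactly as the `θ`-chain of
`ThetaChainCheck.lean` does; the semantic soundness is `MertensSecondChainSound.lean`, the kernel facts
`MertensSecondChainRun1.lean`, the assembly `MertensSecondErrorPositive.lean`.

## The state and one step

A state `⟨p, Llo, Lhi, LL, S⟩` records the last prime `p` reached, natural fixed-point (`2⁸⁰`) enclosures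
`Llo ≤ 2⁸⁰ log p ≤ Lhi`, an upper bound `2⁸⁰ log log p ≤ LL` and a lower bound `S ≤ 2⁸⁰ Σ_{q ≤ p} 1/q`. A step to
the next table entry `p'` (`step`) checks `p < p'`, `p'` odd and prime (`ThetaChain.primeChk`), extends the
enclosure of the logarithm (`ThetaChain.logNext`) and of `log log` by
`log log p' − log log p ≤ log(Lhi'/Llo) = log(1 + (Lhi' − Llo)/Llo)` (`ChainCheck.lnp`, a few terms of the
alternating series — no logarithm is evaluated from scratch), then performs THE comparison `MHI + LL' ≤ S`:
with `B < MHI/2⁸⁰` (the Meissel–Mertens constant, bounded once and for all by `runA`, below) it gives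
`Σ_{q ≤ x} 1/q − log log x − B > 0` for every real `p ≤ x < p'`; finally `S' = S + ⌊2⁸⁰/p'⌋`.
`run`/`runD` iterate along the table cursor `ChainCheck.after p table` with fuel (two chunks of `15 333` steps
reach the prime `358 811`).

The Meissel–Mertens constant: `γ − B = Σ_p a_p`, `a_p = −log(1 − 1/p) − 1/p = log(1 + 1/(p−1)) − 1/p > 0`
(Hardy–Wright (22.8.1); tree: `Mertens.meisselMertens`, `Mertens.tsum_primeLogCoeffSubInv`). `stepA`/`runA`
accumulate two-sided fixed-point bounds `A ≤ 2⁸⁰ Σ_{3 ≤ q ≤ p} a_q ≤ Ahi` along the same table (`lnp 1 (p−1)`), up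
to the prime `30 011`; the tail `Σ_{q > P} a_q < 1/(P−1)` is elementary. Constants: `MHI` (so that
`B < MHI/2⁸⁰ = 0.2614988…`), `initE` (the state at `p = 3`, with `LL₃ ≥ 2⁸⁰ log log 3` from one kernel logarithm,
checked in the soundness file).

All arithmetic is on `ℕ` with the kernel's accelerated primitives, as in `ThetaChainCheck.lean`. Nothing is
asserted here: the `def`s are computable functions and constants. [RosserSchoenfeld1962] [Zhao2025MertensMean]
-/

namespace Literature.NumberTheory.LFunctions.MertensSecondChain

open ChainCheck ChainTable ThetaChain

/-! ### States and one step of the `E₂`-chain -/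

/-- A state of the `E₂`-chain: the prime `p` reached, `Llo ≤ 2⁸⁰ log p ≤ Lhi`, `2⁸⁰ log log p ≤ LL`,
`S ≤ 2⁸⁰ Σ_{q ≤ p} 1/q` (bookkeeping for the certificate of «`E₂(x) > 0`, `2 ≤ x ≤ 10⁸`»).
[cite: Zhao2025MertensMean, §1.1 («E_i(x) > 0 for 2 ≤ x ≤ 10⁸» [RS])] -/
structure ES where
  /-- the last prime reached -/
  p : ℕ
  /-- lower bound of `2⁸⁰ log p` -/
  Llo : ℕ
  /-- upper bound of `2⁸⁰ log p` -/
  Lhi : ℕ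
  /-- upper bound of `2⁸⁰ log log p` -/
  LL : ℕ
  /-- lower bound of `2⁸⁰ Σ_{q ≤ p} 1/q` -/
  S : ℕ
  deriving Repr, DecidableEq

/-- `MHI`: `2⁸⁰ B < MHI` for the Meissel–Mertens constant `B = 0.26149 72128…`
(`MHI/2⁸⁰ = 0.26149 88…`; `MertensSecondChainSound.meisselMertens_lt`). [folklore] -/
def MHI : ℕ := 316132578643413543554498

/-- **One step** of the `E₂`-chain to the next table entry `p'`: order, parity, primality; the new enclosures
of `log p'` and `log log p'`; the comparison `MHI + LL' ≤ S` (positivity of `E₂` on `[p, p')`); the new sum.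
[folklore] -/
def step (s : ES) (p' : ℕ) : Option ES :=
  match s with
  | ⟨p, Llo, Lhi, LL, S⟩ =>
    bif !(Nat.blt p p' && Nat.beq (Nat.mod p' 2) 1 && primeChk p') then none else
    match logNext p Llo Lhi p' with
    | none => none
    | some (Llo', Lhi') =>
      let d := Nat.sub Lhi' Llo
      bif !(Nat.blt 0 Llo' && Nat.ble Llo Lhi' && Nat.ble (Nat.mul 2 d) Llo) then none else
      match lnp d Llo with
      | (_, dhi) =>
        let LL' := Nat.add LL dhi
        bif !(Nat.ble (Nat.add MHI LL') S) then none
        else some ⟨p', Llo', Lhi', LL', Nat.add S (Nat.div SC p')⟩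

/-- Run over a segment of the table with fuel (a chunk). [folklore] -/
def run : ℕ → ES → List ℕ → Option ES
  | 0, s, _ => some s
  | _ + 1, s, [] => some s
  | fuel + 1, s, p' :: rest =>
    match step s p' with
    | none => none
    | some s' => run fuel s' rest

/-- **A chunk of the run**: at most `fuel` table entries after the state's prime. [folklore] -/
def runD (fuel : ℕ) (s : ES) : Option ES := run fuel s (ChainCheck.after s.p table)

/-- The initial state at `p = 3`: `logIv 3 = (1328140761516560292552947, 1328140761517035898327275)`,
`LL₃ = 113696847084947482087084 ≥ 2⁸⁰ log log 3` (one kernel logarithm of `Lhi₃`, checked in the soundness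
file), `S₃ = ⌊2⁸⁰/2⌋ + ⌊2⁸⁰/3⌋`. [folklore] -/
def initE : ES :=
  ⟨3, 1328140761516560292552947, 1328140761517035898327275, 113696847084947482087084,
    Nat.add (Nat.div SC 2) (Nat.div SC 3)⟩

/-! ### The Meissel–Mertens constant: `Σ_p a_p`, `a_p = log(1 + 1/(p−1)) − 1/p` -/

/-- A state of the `a_p`-accumulation: the prime `p` reached and `A ≤ 2⁸⁰ Σ_{3 ≤ q ≤ p} a_q ≤ Ahi` (bookkeeping for
the enclosure of the Meissel–Mertens constant `B = γ − Σ_p a_p = 0.26149 72128…`).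
[cite: RosserSchoenfeld1962, (2.10) (the constant B)] -/
structure AS where
  /-- the last prime reached -/
  p : ℕ
  /-- lower bound of the partial sum (scaled) -/
  A : ℕ
  /-- upper bound of the partial sum (scaled) -/
  Ahi : ℕ
  deriving Repr, DecidableEq

/-- One step of the accumulation: `a_{p'} ∈ [lo − ⌊2⁸⁰/p'⌋ − 1, hi − ⌊2⁸⁰/p'⌋]/2⁸⁰`, `(lo, hi) = lnp 1 (p'−1)`.
(The comparisons `⌊2⁸⁰/p'⌋ ≤ hi`, `A' ≤ Ahi'` keep the natural subtractions exact and force evaluation.) [folklore] -/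
def stepA (s : AS) (p' : ℕ) : Option AS :=
  match s with
  | ⟨p, A, Ahi⟩ =>
    bif !(Nat.blt p p' && Nat.beq (Nat.mod p' 2) 1 && primeChk p') then none else
    match lnp 1 (Nat.sub p' 1) with
    | (alo, ahi) =>
      let A' := Nat.add A (Nat.sub alo (Nat.add (Nat.div SC p') 1))
      let Ahi' := Nat.add Ahi (Nat.sub ahi (Nat.div SC p'))
      bif !(Nat.ble (Nat.div SC p') ahi && Nat.ble A' Ahi') then none else some ⟨p', A', Ahi'⟩

/-- Run of the accumulation over a table segment. [folklore] -/
def runA : ℕ → AS → List ℕ → Option AS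
  | 0, s, _ => some s
  | _ + 1, s, [] => some s
  | fuel + 1, s, p' :: rest =>
    match stepA s p' with
    | none => none
    | some s' => runA fuel s' rest

/-- A chunk of the accumulation. [folklore] -/
def runDA (fuel : ℕ) (s : AS) : Option AS := runA fuel s (ChainCheck.after s.p table)

/-- The initial accumulation state at `p = 3`: `a_3 = log(3/2) − 1/3 ∈ [lo − ⌊2⁸⁰/3⌋ − 1, hi − ⌊2⁸⁰/3⌋]/2⁸⁰`
with `(lo, hi) = lnp 1 2`. [folklore] -/
def initA : AS :=
  match lnp 1 2 with
  | (alo, ahi) => ⟨3, Nat.sub alo (Nat.add (Nat.div SC 3) 1), Nat.sub ahi (Nat.div SC 3)⟩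

end Literature.NumberTheory.LFunctions.MertensSecondChain
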